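import Summits.HodgeConjecture.HodgeConjecture.Theorems.GenericDivisibilityGenericDivisibilityBoundedSupportedTop
import Summits.HodgeConjecture.HodgeConjecture.Theorems.GenericDivisibilityGenericDivisibilityBoundedCruxAtOfSurjective
import Literature.AlgebraicGeometry.HodgeTheory.ProperModificationCohomologySpanning
import Literature.AlgebraicGeometry.HodgeTheory.ComplexOrientationDegreeOne
import Literature.AlgebraicTopology.SingularHomology.GysinMapSupportProofs
import Literature.Geometry.Manifold.DeRhamFundamentalClassPairing
import HarnessLib

/-!
# The crux `GenericDivisibilityBounded` (C2, stmt-HodgeConjecture-18467) ASCENDS along birational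
# morphisms of smooth projective varieties: C2 is a birational invariant

Line `finite-level-bootstrap`, registered sub-goal `stub_cruxAtOfBirationalUp` (lead c4). Sorry-free,
definition-free. `σ : X' ⟶ X` is a `ℂ`-morphism of smooth projective `n`-folds with `σ.left`
birational (an isomorphism over a dense open `U ⊆ X`), `f = σ(ℂ)`, `H = H^k(–(ℂ); ℤ)`,
`z| = z|_{(X∖Z)(ℂ)}`, "`x ∈ GT`" (generically torsion) means `∃ Z` closed `≠ univ`, `∃ N ≥ 1`,
`N • x| = 0`, and "C2 at `X` in degree `k`" is: every `z ∈ H^k(X(ℂ);ℤ)` which for every `m ≥ 1` is an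
`m`-multiple on the complex points of some non-empty Zariski open has complexification in
`N¹ = supportedClasses X k 1`. The landed `…CruxAtOfSurjective` proves C2 DESCENDS along `σ`; this
file proves the converse: C2 in degree `k ≥ 1` is a birational invariant of smooth projective varieties.

## The argument (Voisin I, proof of Thm. 7.31 first step; Fulton, Lemma 19.1.2)

Let `G = σ_! : H^k(X'(ℂ);ℤ) → H^k(X(ℂ);ℤ)` be the INTEGRAL Gysin map for the complex orientations
(`gysinMap (complexOrientationInt hX') (complexOrientationInt hX)`), of degree one
(`hasDegree_one_complexOrientationInt_of_isBirational`), so `G σ^* = id` (projection formula). For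
`z'` on `X'` put `z = G z'` and `κ = z' - σ^* z`, so `G κ = 0`.

* (A) **`κ ∈ GT(X')`.** Over `ℂ`, `σ_!^ℂ (κ ⊗ ℂ) = 0` for ANY `ℂ`-orientations
  (`…_gysinMap_ringChange_eq_zero`: the `ℂ`-fundamental class of the connected closed manifold
  `X'(ℂ)` is a multiple of `[X'(ℂ)]_ℤ ⊗ 1`, and change of coefficients commutes with cap products
  and push-forward), hence `κ ⊗ ℂ` dies on `(σ⁻¹U)(ℂ)` (`…_restrictCompl_eq_zero_of_gysinMap_eq_zero`,
  from the tree's `exists_restrictCompl_sub_map_eq_zero_of_isIso_restrict` — every class is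
  `σ^* y +` a class dying on `(σ⁻¹U)(ℂ)` — and `gysinMap_restrictCompl_eq_zero_of_field`), so
  `κ ⊗ ℂ ∈ N¹(X')` and `κ ∈ GT(X')` (`GT = N¹ ∩ H_ℤ`, the landed `…SupportedTop`).
* (B) **`N • z` is generically divisible on `X`** if `z'` is on `X'`: on the complement of
  `Z'_m ∪ E₁` one has `N • (σ^* z)| = N • z'| = m • (N • y_m|)`, and over the iso locus `σ(ℂ)`
  restricts to a HOMEOMORPHISM `(X' ∖ σ⁻¹T)(ℂ) ≃ₜ (X ∖ T)(ℂ)` for every `T ⊇ X ∖ U`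
  (`…_exists_homeomorph_compl`: bijective by `AlgPoints.eq_of_map_eq_of_isIso_restrict` /
  `exists_map_eq_of_isIso_restrict`, closed since `σ(ℂ)` is closed), along which the relation is
  transported down to `X ∖ T`, `T = σ(Z'_m ∪ E₁) ∪ (X ∖ U)` (closed: `σ` is proper; `≠ X`: `σ` is
  injective over `U`).
* (C) C2 at `X` gives `(N • z) ⊗ ℂ ∈ N¹(X)`, so `z ∈ GT(X)`, so `σ^* z ∈ GT(X')` (restriction commutes
  with pull-back, `σ` is onto), and `z' = σ^* z + κ ∈ GT(X')`, whence `z' ⊗ ℂ ∈ N¹(X')`.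

## Main results

* `genericDivisibilityBounded_gysinMap_ringChange_eq_zero`,
  `genericDivisibilityBounded_restrictCompl_eq_zero_of_gysinMap_eq_zero` — part (A);
* `genericDivisibilityBounded_base_injOn_preimage`, `…_exists_homeomorph_compl`,
  `…_image_union_isClosed_ne_univ` — the iso locus, on scheme points and on complex points;
* `genericDivisibilityBounded_at_of_isBirational_up` — **C2 at `X` in degree `k ≥ 1` implies C2 at
  `X'` in degree `k`**, for `σ : X' ⟶ X` birational between smooth projective `n`-folds;
* `stub_cruxAtOfBirationalUp` — the registered signature, verbatim (`n = k = 2p`).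

References: [VoisinHodgeI2002] §7.3.2 Lemma 7.28, proof of Thm. 7.31; [VoisinHodgeII2003] §10.2
proof of Thm. 10.17; [FultonYoungTableaux1997] App. B §B.1 (5)–(7); [Fulton1998] Lemma 19.1.2;
[HatcherAT2002] §3.1, §3.3 Thm. 3.30; [ColliotTheleneVoisin2012] Thm. 2.8 (iii), Prop. 3.4; [SGA1]
XII Prop. 3.1 (xi).
-/

set_option linter.dupNamespace false

noncomputable section

namespace Summit.HodgeConjecture.HodgeConjecture.Theorems

open CategoryTheory AlgebraicGeometry
open Literature.AlgebraicGeometry.Motives Literature.AlgebraicGeometry.HodgeTheory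
  Literature.AlgebraicTopology.SingularHomology

/-- Restriction `H^k(X(ℂ);ℤ) → H^k((X∖Z)(ℂ);ℤ)`, the very term of the route decls (notation only). -/
local notation3 (prettyPrint := false) "Res[" X ", " Z ", " k "]" =>
  singularCohomology.map ℤ ℤ
    (⟨Subtype.val, continuous_subtype_val⟩ : C(complexPointsCompl X Z, ComplexPoints X)) k

/-- The inclusion `(X ∖ Z')(ℂ) ↪ (X ∖ Z)(ℂ)` for `h : Z ⊆ Z'`, spelled as in
`genericDivisibility_restrict_restrict` (notation only). -/
local notation3 (prettyPrint := false) "Incl[" X ", " Z ", " Z' ", " h "]" =>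
  (⟨fun P : complexPointsCompl X Z' => (⟨P.1, fun hP : P.1.pt ∈ Z => P.2 (h hP)⟩ :
      complexPointsCompl X Z),
    continuous_subtype_val.subtype_mk fun (P : complexPointsCompl X Z') (hP : P.1.pt ∈ Z) =>
      P.2 (h hP)⟩ : C(complexPointsCompl X Z', complexPointsCompl X Z))

variable {n : ℕ} {X' X : SchemeOver ℂ}

/-! ### (A) A class killed by the integral Gysin map of `σ` is generically torsion -/

/-- **From `ℤ` to `ℂ`: a class killed by the integral Gysin map is killed, after complexification,
by every complex Gysin map.** For `X'`, `X` smooth projective of dimension `n`, `f : X'(ℂ) → X(ℂ)`,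
`κ ∈ H^k(X'(ℂ);ℤ)` with `f_! κ = 0` for the complex `ℤ`-orientations, and ANY `ℂ`-orientations
`μ`, `ν`: `f_!(κ ⊗ ℂ) = 0`. Indeed `[X'(ℂ)]_μ = r • ([X'(ℂ)]_ℤ ⊗ 1)` (`H_{2n}` of the closed connected
`X'(ℂ)` over `ℂ` is a line, Hatcher Thm. 3.26), so
`f_!(κ ⊗ ℂ) ⌢ [X]_ν = f_*((κ ⊗ ℂ) ⌢ [X']_μ) = r • (f_*(κ ⌢ [X']_ℤ)) ⊗ 1 = r • ((f_! κ) ⌢ [X]_ℤ) ⊗ 1 = 0`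
(change of coefficients commutes with cap products and push-forward, Hatcher §3.3 pp. 239–241), and
`⌢ [X]_ν` is injective (Poincaré duality, Thm. 3.30).
[cite: HatcherAT2002, §3.3 Thm. 3.26, Thm. 3.30 and pp. 239–241] [cite: FultonYoungTableaux1997, Appendix B §B.1 (5)] -/
theorem genericDivisibilityBounded_gysinMap_ringChange_eq_zero (hX' : IsSmoothProjective n X')
    (hX : IsSmoothProjective n X) (f : C(ComplexPoints X', ComplexPoints X))
    (μ : HomologicalOrientation ℂ (ComplexPoints X') (2 * n))
    (ν : HomologicalOrientation ℂ (ComplexPoints X) (2 * n)) {k q : ℕ} (h : k + q = 2 * n)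
    (κ : singularCohomology ℤ ℤ (ComplexPoints X') k)
    (hκ : gysinMap (complexOrientationInt hX') (complexOrientationInt hX) f h h κ = 0) :
    gysinMap μ ν f h h (singularCohomology.ringChange (Int.castRingHom ℂ) (ComplexPoints X') k κ) = 0 := by
  letI := hX.chartedSpace
  letI := hX'.chartedSpace
  haveI := ComplexPoints.compactSpace_of_isSmoothProjective hX
  haveI := ComplexPoints.compactSpace_of_isSmoothProjective hX'
  haveI := ComplexPoints.t2Space_of_isSmoothProjective hX
  haveI := ComplexPoints.t2Space_of_isSmoothProjective hX'
  haveI := connectedSpace_complexPoints hX'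
  have hνPD : ν.HasPoincareDuality := fun _ _ h' ↦ poincare_duality ν h'
  have hPDℤ : (complexOrientationInt hX).HasPoincareDuality := fun _ _ h' ↦ poincare_duality _ h'
  obtain ⟨r, hr⟩ := Literature.Geometry.Manifold.exists_eq_smul_coeffChange_fundamentalClass ℂ
    (complexOrientationInt hX') μ.fundamentalClass
  rw [algebraMap_int_eq] at hr
  apply (hνPD h).1
  rw [map_zero, poincareDualityMap_apply, capProduct_gysinMap hνPD f h h, hr, map_smul, map_smul,
    ← singularHomology.coeffChange_capProduct, ← singularHomology.coeffChange_map,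
    ← capProduct_gysinMap hPDℤ f h h κ, hκ, map_zero, LinearMap.zero_apply, map_zero, smul_zero]

/-- **A complex class killed by the Gysin map of a birational `σ` dies on the complex points of the
iso locus `σ⁻¹U`.** Let `σ : X' ⟶ X` be birational between smooth projective `n`-folds, an
isomorphism over the open `U ⊆ X`, `μ`, `ν` `ℂ`-orientations with `σ(ℂ)_*[X'] = [X]`, and
`w ∈ H^k(X'(ℂ);ℂ)` with `σ_! w = 0`. Then `w|_{(σ⁻¹U)(ℂ)} = 0`: `w = σ^* y + w₀` with `w₀` dying on
`(σ⁻¹U)(ℂ)` (Voisin I, proof of Thm. 7.31, first step: the tree's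
`exists_restrictCompl_sub_map_eq_zero_of_isIso_restrict`), `y = -σ_! w₀` (`σ_! σ^* = id`,
`gysinMap_map_of_hasDegree`), and `σ_! w₀` dies on `U(ℂ)` because `w₀` dies on
`(σ⁻¹U)(ℂ) = σ(ℂ)⁻¹(U(ℂ))` (Gysin maps respect supports over a field,
`gysinMap_restrictCompl_eq_zero_of_field`; Fulton, *Young Tableaux* App. B Exercise 5), so
`σ^* y = -(σ^* σ_! w₀)` dies on `(σ⁻¹U)(ℂ)` (restriction commutes with pull-back).
[cite: VoisinHodgeI2002, §7.3.2 Lemma 7.28 and proof of Thm. 7.31]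
[cite: FultonYoungTableaux1997, Appendix B §B.2 Exercise 5 with (26) and (30)] -/
theorem genericDivisibilityBounded_restrictCompl_eq_zero_of_gysinMap_eq_zero
    (hX' : IsSmoothProjective n X') (hX : IsSmoothProjective n X) (σ : X' ⟶ X)
    (hσ : Literature.AlgebraicGeometry.Resolution.IsBirational σ.left) (U : X.left.Opens)
    [IsIso (σ.left ∣_ U)] (μ : HomologicalOrientation ℂ (ComplexPoints X') (2 * n))
    (ν : HomologicalOrientation ℂ (ComplexPoints X) (2 * n))
    (hdeg : HasDegree μ ν (AlgPoints.mapContinuous (L := ℂ) σ) 1) {k q : ℕ} (h : k + q = 2 * n)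
    (w : complexBetti X' k) (hw : gysinMap μ ν (AlgPoints.mapContinuous (L := ℂ) σ) h h w = 0) :
    complexBetti.restrictCompl X' (σ.left.base ⁻¹' (U : Set X.left)ᶜ) k w = 0 := by
  letI := hX.chartedSpace
  letI := hX'.chartedSpace
  haveI := ComplexPoints.compactSpace_of_isSmoothProjective hX
  haveI := ComplexPoints.compactSpace_of_isSmoothProjective hX'
  haveI := ComplexPoints.t2Space_of_isSmoothProjective hX
  haveI := ComplexPoints.t2Space_of_isSmoothProjective hX'
  have hνPD : ν.HasPoincareDuality := fun _ _ h' ↦ poincare_duality ν h'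
  set f : C(ComplexPoints X', ComplexPoints X) := AlgPoints.mapContinuous (L := ℂ) σ with hf
  -- `w = σ^* y + w₀` with `w₀` dying on `(σ⁻¹U)(ℂ)`
  obtain ⟨y, hy⟩ := exists_restrictCompl_sub_map_eq_zero_of_isIso_restrict hX' hX σ hσ U k w
  set w₀ : complexBetti X' k := w - complexBetti.map σ k y with hw₀
  -- `y = -σ_! w₀`
  have hyG : y = -gysinMap μ ν f h h w₀ := by
    rw [hw₀, map_sub]
    change y = -(gysinMap μ ν f h h w - gysinMap μ ν f h h (singularCohomology.map ℂ ℂ f k y))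
    rw [hw, gysinMap_map_of_hasDegree hνPD hdeg h, one_smul, zero_sub, neg_neg]
  -- `σ_! w₀` dies on `U(ℂ)`: Gysin maps respect supports over a field
  set K : Set (ComplexPoints X) := {P | P.pt ∈ (U : Set X.left)ᶜ} with hK
  have hKc : IsClosed K := isClosed_setOf_pt_mem U.2.isClosed_compl
  have hw₀' : singularCohomology.map ℂ ℂ
      (⟨Subtype.val, continuous_subtype_val⟩ : C({y' : ComplexPoints X' // f y' ∉ K}, ComplexPoints X'))
      k w₀ = 0 := hy
  have hGU : complexBetti.restrictCompl X (U : Set X.left)ᶜ k (gysinMap μ ν f h h w₀) = 0 :=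
    gysinMap_restrictCompl_eq_zero_of_field ℂ μ ν hνPD f h h hKc w₀ hw₀'
  -- conclude: `w| = w₀| + (σ^* y)| = 0 - (σ|)^*((σ_! w₀)|) = 0`
  have hsplit : w = w₀ + complexBetti.map σ k y := (sub_add_cancel w _).symm
  have h1 : complexBetti.restrictCompl X' (σ.left.base ⁻¹' (U : Set X.left)ᶜ) k w₀ = 0 := hy
  rw [hsplit, map_add, h1, zero_add, hyG, map_neg, map_neg, ← ModuleCat.comp_apply,
    complexBetti.restrictCompl_map, ModuleCat.comp_apply, hGU, map_zero, neg_zero]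

/-! ### The iso locus: scheme points and complex points -/

/-- A morphism which is an isomorphism over the open `U` is injective on the scheme points of
`σ⁻¹U` (the restriction `σ|_U : σ⁻¹U ⟶ U` is an open immersion, hence an open embedding).
[cite: SGA1, Exp. XII Prop. 3.1 (xi)] -/
theorem genericDivisibilityBounded_base_injOn_preimage (σ : X' ⟶ X) (U : X.left.Opens)
    [IsIso (σ.left ∣_ U)] : Set.InjOn σ.left.base (σ.left ⁻¹ᵁ U : Set X'.left) := by
  haveI : IsOpenImmersion (σ.left ∣_ U) := inferInstance
  intro a ha b hb hab
  have hinj := (σ.left ∣_ U).isOpenEmbedding.injective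
  have h := @hinj ⟨a, ha⟩ ⟨b, hb⟩ (Subtype.ext (by
    rw [morphismRestrict_base_coe, morphismRestrict_base_coe]; exact hab))
  exact congrArg Subtype.val h

/-- **`σ(ℂ)` is a homeomorphism over the iso locus.** For `σ : X' ⟶ X` an isomorphism over the open
`U ⊆ X`, `X'` smooth projective (so `X'(ℂ)` is compact) and `X` smooth projective (so `X(ℂ)` is
Hausdorff), and any `T ⊇ X ∖ U`, the map `σ(ℂ)` restricts to a homeomorphism
`(X' ∖ σ⁻¹T)(ℂ) ≃ₜ (X ∖ T)(ℂ)`: it is injective over `U(ℂ)` and onto `U(ℂ)`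
(`AlgPoints.eq_of_map_eq_of_isIso_restrict`, `AlgPoints.exists_map_eq_of_isIso_restrict`, SGA1 XII),
and closed, being the restriction over a subset of the target of the closed map `σ(ℂ)` (compact to
Hausdorff); a closed continuous bijection is a homeomorphism. [cite: SGA1, Exp. XII Prop. 3.1 (xi)]
[cite: Spanier1981, Ch. 6 §6, p. 318] -/
theorem genericDivisibilityBounded_exists_homeomorph_compl (hX' : IsSmoothProjective n X')
    (hX : IsSmoothProjective n X) (σ : X' ⟶ X) (U : X.left.Opens) [IsIso (σ.left ∣_ U)]
    {T : Set X.left} (hT : (U : Set X.left)ᶜ ⊆ T) :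
    ∃ e : complexPointsCompl X' (σ.left.base ⁻¹' T) ≃ₜ complexPointsCompl X T,
      (e : C(complexPointsCompl X' (σ.left.base ⁻¹' T), complexPointsCompl X T)) =
        complexPointsComplMap σ T := by
  haveI := ComplexPoints.compactSpace_of_isSmoothProjective hX'
  haveI := ComplexPoints.t2Space_of_isSmoothProjective hX
  set f : C(ComplexPoints X', ComplexPoints X) := AlgPoints.mapContinuous (L := ℂ) σ with hf
  have hfc : IsClosedMap f := f.continuous.isClosedMap
  set g : complexPointsCompl X' (σ.left.base ⁻¹' T) → complexPointsCompl X T :=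
    fun Q ↦ complexPointsComplMap σ T Q with hg
  have hg : Function.Bijective g := by
    refine ⟨fun a b hab ↦ Subtype.ext ?_, fun P ↦ ?_⟩
    · have haU : (AlgPoints.map σ a.1).pt ∈ U := by
        by_contra haU
        exact a.2 (hT haU)
      exact AlgPoints.eq_of_map_eq_of_isIso_restrict σ U haU (congrArg Subtype.val hab)
    · have hPU : P.1.pt ∈ U := by
        by_contra hPU
        exact P.2 (hT hPU)
      obtain ⟨Q, hQ⟩ := AlgPoints.exists_map_eq_of_isIso_restrict σ U P.1 hPU
      refine ⟨⟨Q, fun hQT ↦ P.2 ?_⟩, Subtype.ext hQ⟩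
      have e : P.1.pt = (AlgPoints.map σ Q).pt := by rw [hQ]
      rw [e]
      exact hQT
  have hgc : IsClosedMap g := hfc.restrictPreimage {P : ComplexPoints X | P.pt ∉ T}
  let e : complexPointsCompl X' (σ.left.base ⁻¹' T) ≃ₜ complexPointsCompl X T :=
    { toEquiv := Equiv.ofBijective g hg
      continuous_toFun := (complexPointsComplMap σ T).continuous
      continuous_invFun := by
        rw [continuous_iff_isClosed]
        intro s hs
        change IsClosed ((Equiv.ofBijective g hg).symm ⁻¹' s)
        rw [← Equiv.image_eq_preimage_symm]
        exact hgc s hs }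
  exact ⟨e, rfl⟩

/-- **Transporting a proper closed subset down through the iso locus.** For `σ : X' ⟶ X` proper
(e.g. a morphism of smooth projective varieties) and an isomorphism over the open `U ⊆ X`, and
`S ⊆ X'` closed with `S ∪ σ⁻¹(X ∖ U) ≠ X'`, the subset `T = σ(S) ∪ (X ∖ U)` is closed (`σ` is a closed
map) and `≠ X`: a point `x₀ ∉ S ∪ σ⁻¹(X ∖ U)` has `σ x₀ ∈ U`, and `σ x₀ ∉ σ(S)` because `σ` is
injective over `U`. [cite: SGA1, Exp. XII Prop. 3.1 (xi)] -/
theorem genericDivisibilityBounded_image_union_isClosed_ne_univ (hX' : IsSmoothProjective n X')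
    (hX : IsSmoothProjective n X) (σ : X' ⟶ X) (U : X.left.Opens) [IsIso (σ.left ∣_ U)]
    {S : Set X'.left} (hS : IsClosed S) (hSne : S ∪ σ.left.base ⁻¹' (U : Set X.left)ᶜ ≠ Set.univ) :
    IsClosed (σ.left.base '' S ∪ (U : Set X.left)ᶜ) ∧ σ.left.base '' S ∪ (U : Set X.left)ᶜ ≠ Set.univ := by
  haveI : IsProper σ.left := isProper_left_of_isSmoothProjective hX' hX σ
  refine ⟨(σ.left.isClosedMap S hS).union U.2.isClosed_compl, ?_⟩
  obtain ⟨x₀, hx₀⟩ := (Set.ne_univ_iff_exists_notMem _).1 hSne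
  rw [Set.mem_union, not_or] at hx₀
  have hx₀U : σ.left.base x₀ ∈ (U : Set X.left) := by
    by_contra h'
    exact hx₀.2 h'
  rw [Set.ne_univ_iff_exists_notMem]
  refine ⟨σ.left.base x₀, ?_⟩
  rintro (⟨s, hs, hsx⟩ | hU)
  · have hsU : σ.left.base s ∈ (U : Set X.left) := by rw [hsx]; exact hx₀U
    have hsx₀ : s = x₀ := genericDivisibilityBounded_base_injOn_preimage σ U hsU hx₀U hsx
    exact hx₀.1 (hsx₀ ▸ hs)
  · exact hU hx₀U

/-! ### (B)–(C) C2 ascends along birational morphisms -/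

/-- **C2 ascends along birational morphisms of smooth projective varieties.** Let `σ : X' ⟶ X` be a
`ℂ`-morphism of smooth projective `n`-folds with `σ.left` birational, `k ≥ 1`, `k + q = 2n`, and
suppose C2 holds at `X` in degree `k`. Then C2 holds at `X'` in degree `k`. With `G = σ_!` the
integral Gysin map for the complex orientations (degree one, Fulton Lemma 19.1.2), `z = G z'`,
`κ = z' - σ^* z`: (A) `G κ = 0`, so `κ ⊗ ℂ` dies on `(σ⁻¹U)(ℂ)`, lies in `N¹(X')`, and `κ ∈ GT(X')`
(`GT = N¹ ∩ H_ℤ`); (B) for each `m`, on the complement of `Z'_m ∪ E₁` one has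
`N • (σ^* z)| = m • (N • y_m|)`, transported DOWN to `X ∖ T`, `T = σ(Z'_m ∪ E₁) ∪ (X ∖ U)`, along the
homeomorphism `(X' ∖ σ⁻¹T)(ℂ) ≃ₜ (X ∖ T)(ℂ)`; so `N • z` is generically divisible on `X`; (C) C2 at
`X`: `(N • z) ⊗ ℂ ∈ N¹(X)`, so `z ∈ GT(X)`, `σ^* z ∈ GT(X')` (`σ` onto), `z' = σ^* z + κ ∈ GT(X')`, and
`z' ⊗ ℂ ∈ N¹(X')`. [cite: VoisinHodgeI2002, §7.3.2 Lemma 7.28 and proof of Thm. 7.31]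
[cite: Fulton1998, Lemma 19.1.2] [cite: ColliotTheleneVoisin2012, Thm. 2.8 (iii) and Prop. 3.4] -/
theorem genericDivisibilityBounded_at_of_isBirational_up (hX' : IsSmoothProjective n X')
    (hX : IsSmoothProjective n X) (σ : X' ⟶ X)
    (hσ : Literature.AlgebraicGeometry.Resolution.IsBirational σ.left) {k q : ℕ} (hk : 1 ≤ k)
    (h : k + q = 2 * n)
    (hC : ∀ z : singularCohomology ℤ ℤ (ComplexPoints X) k,
      (∀ m : ℕ, 1 ≤ m → ∃ Z : Set X.left, IsClosed Z ∧ Z ≠ Set.univ ∧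
        ∃ y : singularCohomology ℤ ℤ (complexPointsCompl X Z) k, m • y = Res[X, Z, k] z) →
      singularCohomology.ringChange (Int.castRingHom ℂ) (ComplexPoints X) k z ∈
        supportedClasses X k 1)
    (z' : singularCohomology ℤ ℤ (ComplexPoints X') k)
    (hz' : ∀ m : ℕ, 1 ≤ m → ∃ Z : Set X'.left, IsClosed Z ∧ Z ≠ Set.univ ∧
      ∃ y : singularCohomology ℤ ℤ (complexPointsCompl X' Z) k, m • y = Res[X', Z, k] z') :
    singularCohomology.ringChange (Int.castRingHom ℂ) (ComplexPoints X') k z' ∈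
      supportedClasses X' k 1 := by
  letI := hX.chartedSpace
  letI := hX'.chartedSpace
  haveI := ComplexPoints.compactSpace_of_isSmoothProjective hX
  haveI := ComplexPoints.compactSpace_of_isSmoothProjective hX'
  haveI := ComplexPoints.t2Space_of_isSmoothProjective hX
  haveI := ComplexPoints.t2Space_of_isSmoothProjective hX'
  haveI : IsIntegral X'.left := IsSmoothProjective.isIntegral_holds hX'
  haveI : IsIntegral X.left := IsSmoothProjective.isIntegral_holds hX
  haveI : IsProper σ.left := isProper_left_of_isSmoothProjective hX' hX σ
  have hsurj : Function.Surjective σ.left.base := surjective_base_of_isBirational σ.left hσ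
  have hσ' := hσ
  obtain ⟨U, -, hU', hiso⟩ := hσ'
  haveI : IsIso (σ.left ∣_ U) := hiso
  set f : C(ComplexPoints X', ComplexPoints X) := AlgPoints.mapContinuous (L := ℂ) σ with hf
  -- the integral Gysin map `G = σ_!`, of degree one
  have hPDℤ : (complexOrientationInt hX).HasPoincareDuality := fun _ _ h' ↦ poincare_duality _ h'
  have hdegℤ := hasDegree_one_complexOrientationInt_of_isBirational hX' hX σ hσ
  set G := gysinMap (complexOrientationInt hX') (complexOrientationInt hX) f h h with hG
  set z : singularCohomology ℤ ℤ (ComplexPoints X) k := G z' with hz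
  set κ : singularCohomology ℤ ℤ (ComplexPoints X') k := z' - singularCohomology.map ℤ ℤ f k z
    with hκ
  have hGκ : G κ = 0 := by
    rw [hκ, map_sub, hz, hG, gysinMap_map_of_hasDegree hPDℤ hdegℤ h, one_smul, sub_self]
  -- (A) `κ ⊗ ℂ ∈ N¹(X')`, hence `κ ∈ GT(X')`
  obtain ⟨μ, ν, hdeg⟩ := exists_hasDegree_one_of_isBirational hX' hX σ hσ
  have hA := genericDivisibilityBounded_restrictCompl_eq_zero_of_gysinMap_eq_zero hX' hX σ hσ U μ ν
    hdeg h _ (genericDivisibilityBounded_gysinMap_ringChange_eq_zero hX' hX f μ ν h κ hGκ)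
  have hE : IsClosed (σ.left.base ⁻¹' (U : Set X.left)ᶜ) :=
    U.2.isClosed_compl.preimage σ.left.continuous
  have hEne : σ.left.base ⁻¹' (U : Set X.left)ᶜ ≠ Set.univ := by
    obtain ⟨x, hx⟩ := hU'.nonempty
    exact fun hu ↦ (hu ▸ Set.mem_univ x : x ∈ σ.left.base ⁻¹' (U : Set X.left)ᶜ) hx
  have hκN : singularCohomology.ringChange (Int.castRingHom ℂ) (ComplexPoints X') k κ ∈
      supportedClasses X' k 1 :=
    mem_supportedClasses_of_restrictCompl_eq_zero hE ((forall_one_le_coheight_iff_ne_univ hE).2 hEne) hA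
  obtain ⟨E₁, hE₁, hE₁ne, N, hN, hNκ⟩ :=
    genericDivisibilityBounded_exists_nsmul_restrict_eq_zero_of_ringChange_mem_supportedClasses hX'
      hk hκN
  have hfz : singularCohomology.map ℤ ℤ f k z = z' - κ := (sub_sub_cancel z' _).symm
  -- (B) `N • z` is generically divisible on `X`
  have hNz : ∀ m : ℕ, 1 ≤ m → ∃ T : Set X.left, IsClosed T ∧ T ≠ Set.univ ∧
      ∃ y : singularCohomology ℤ ℤ (complexPointsCompl X T) k, m • y = Res[X, T, k] (N • z) := by
    intro m hm
    obtain ⟨Z', hZ', hZ'ne, y, hy⟩ := hz' m hm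
    -- the closed `S = Z'_m ∪ E₁` and `T = σ(S) ∪ (X ∖ U)`
    have hS : IsClosed (Z' ∪ E₁) := hZ'.union hE₁
    have hSne : (Z' ∪ E₁) ∪ σ.left.base ⁻¹' (U : Set X.left)ᶜ ≠ Set.univ :=
      genericDivisibilityBounded_union_ne_univ hS hE
        (genericDivisibilityBounded_union_ne_univ hZ' hE₁ hZ'ne hE₁ne) hEne
    obtain ⟨hT, hTne⟩ := genericDivisibilityBounded_image_union_isClosed_ne_univ hX' hX σ U hS hSne
    set T : Set X.left := σ.left.base '' (Z' ∪ E₁) ∪ (U : Set X.left)ᶜ with hTdef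
    have hUT : (U : Set X.left)ᶜ ⊆ T := Set.subset_union_right
    have hST : Z' ∪ E₁ ⊆ σ.left.base ⁻¹' T :=
      (Set.subset_preimage_image _ _).trans (Set.preimage_mono Set.subset_union_left)
    have hZ'T : Z' ⊆ σ.left.base ⁻¹' T := Set.subset_union_left.trans hST
    have hE₁T : E₁ ⊆ σ.left.base ⁻¹' T := Set.subset_union_right.trans hST
    -- on `(X' ∖ σ⁻¹T)(ℂ)`: `N • (σ^* z)| = m • (N • y|)`
    have hyT : Res[X', σ.left.base ⁻¹' T, k] z' =
        m • singularCohomology.map ℤ ℤ Incl[X', Z', σ.left.base ⁻¹' T, hZ'T] k y := by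
      rw [← map_nsmul, hy, genericDivisibility_restrict_restrict ℤ hZ'T]
    have hκT : N • Res[X', σ.left.base ⁻¹' T, k] κ = 0 :=
      genericDivisibilityBounded_nsmul_restrict_mono hE₁T hNκ
    have hrel : N • Res[X', σ.left.base ⁻¹' T, k] (singularCohomology.map ℤ ℤ f k z) =
        m • (N • singularCohomology.map ℤ ℤ Incl[X', Z', σ.left.base ⁻¹' T, hZ'T] k y) := by
      rw [hfz, map_sub, smul_sub, hκT, sub_zero, hyT, smul_comm]
    -- transport down along the homeomorphism `(X' ∖ σ⁻¹T)(ℂ) ≃ₜ (X ∖ T)(ℂ)`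
    obtain ⟨e, he⟩ := genericDivisibilityBounded_exists_homeomorph_compl hX' hX σ U hUT
    rw [genericDivisibilityBounded_restrict_map σ T k z, ← he, ← map_nsmul] at hrel
    refine ⟨T, hT, hTne, singularCohomology.map ℤ ℤ
      (e.symm : C(complexPointsCompl X T, complexPointsCompl X' (σ.left.base ⁻¹' T))) k
        (N • singularCohomology.map ℤ ℤ Incl[X', Z', σ.left.base ⁻¹' T, hZ'T] k y), ?_⟩
    have hinv : ∀ x : singularCohomology ℤ ℤ (complexPointsCompl X T) k,
        singularCohomology.map ℤ ℤ
          (e.symm : C(complexPointsCompl X T, complexPointsCompl X' (σ.left.base ⁻¹' T))) k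
          (singularCohomology.map ℤ ℤ
            (e : C(complexPointsCompl X' (σ.left.base ⁻¹' T), complexPointsCompl X T)) k x) = x := by
      intro x
      rw [← ModuleCat.comp_apply, ← singularCohomology.map_comp, Homeomorph.toContinuousMap_comp_symm,
        singularCohomology.map_id, ModuleCat.id_apply]
    rw [← map_nsmul, ← hrel, hinv, map_nsmul]
  -- (C) C2 at `X` for `N • z`; `z ∈ GT(X)`; `σ^* z ∈ GT(X')`; `z' = σ^* z + κ ∈ GT(X')`
  have hNzN := hC (N • z) hNz
  have hzN : singularCohomology.ringChange (Int.castRingHom ℂ) (ComplexPoints X) k z ∈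
      supportedClasses X k 1 := by
    rw [map_nsmul, ← Nat.cast_smul_eq_nsmul ℂ] at hNzN
    exact ((supportedClasses X k 1).smul_mem_iff (Nat.cast_ne_zero.2 (by omega))).1 hNzN
  obtain ⟨T', hT', hT'ne, N', hN', hN'z⟩ :=
    genericDivisibilityBounded_exists_nsmul_restrict_eq_zero_of_ringChange_mem_supportedClasses hX
      hk hzN
  have hσz : ∃ Z : Set X'.left, IsClosed Z ∧ Z ≠ Set.univ ∧ ∃ N : ℕ, 1 ≤ N ∧
      N • Res[X', Z, k] (singularCohomology.map ℤ ℤ f k z) = 0 :=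
    ⟨σ.left.base ⁻¹' T', hT'.preimage σ.left.continuous,
      genericDivisibilityBounded_preimage_ne_univ σ hsurj hT'ne, N', hN', by
        rw [hf, genericDivisibilityBounded_restrict_map, ← map_nsmul, hN'z, map_zero]⟩
  have hz'eq : z' = singularCohomology.map ℤ ℤ f k z + κ := by rw [hκ, add_sub_cancel]
  rw [hz'eq]
  exact genericDivisibilityBounded_ringChange_mem_supportedClasses hX'
    (genericDivisibilityBounded_genericallyTorsion_add hσz ⟨E₁, hE₁, hE₁ne, N, hN, hNκ⟩)

/-! ### The registered sub-goal -/

/-- **Registered sub-goal `stub_cruxAtOfBirationalUp` of stmt-HodgeConjecture-18467 (line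
`finite-level-bootstrap`): C2 ASCENDS along birational morphisms of smooth projective `2p`-folds** —
for `σ : X' ⟶ X` birational, C2 at `X` implies C2 at `X'`; with the landed `stub_cruxAtOfSurjective`
(C2 descends along `σ`), C2 is a birational invariant. Proof:
`genericDivisibilityBounded_at_of_isBirational_up` at `n = k = q = 2p`.
[cite: VoisinHodgeI2002, §7.3.2 Lemma 7.28 and proof of Thm. 7.31]
[cite: ColliotTheleneVoisin2012, Thm. 2.8 (iii) and Prop. 3.4] -/
theorem stub_cruxAtOfBirationalUp : ∀ ⦃p : ℕ⦄ ⦃X' X : SchemeOver ℂ⦄ (σ : X' ⟶ X), 1 ≤ p → IsSmoothProjective (2 * p) X' → IsSmoothProjective (2 * p) X → Literature.AlgebraicGeometry.Resolution.IsBirational σ.left → (∀ z : singularCohomology ℤ ℤ (ComplexPoints X) (2 * p), (∀ m : ℕ, 1 ≤ m → ∃ Z : Set X.left, IsClosed Z ∧ Z ≠ Set.univ ∧ ∃ y : singularCohomology ℤ ℤ (complexPointsCompl X Z) (2 * p), m • y = singularCohomology.map ℤ ℤ (⟨Subtype.val, continuous_subtype_val⟩ : C(complexPointsCompl X Z, ComplexPoints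 X)) (2 * p) z) → singularCohomology.ringChange (Int.castRingHom ℂ) (ComplexPoints X) (2 * p) z ∈ supportedClasses X (2 * p) 1) → ∀ z' : singularCohomology ℤ ℤ (ComplexPoints X') (2 * p), (∀ m : ℕ, 1 ≤ m → ∃ Z : Set X'.left, IsClosed Z ∧ Z ≠ Set.univ ∧ ∃ y : singularCohomology ℤ ℤ (complexPointsCompl X' Z) (2 * p), m • y = singularCohomology.map ℤ ℤ (⟨Subtype.val, continuous_subtype_val⟩ : C(complexPointsCompl X' Z, ComplexPoints X')) (2 * p) z') → singularCohomology.ringChange (Int.castRingHom ℂ) (ComplexPoints X') (2 * p) z' ∈ supportedClasses X' (2 * p) 1 :=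
  fun p _ _ σ hp hX' hX hσ hC z' hz' ↦
    genericDivisibilityBounded_at_of_isBirational_up hX' hX σ hσ (k := 2 * p) (q := 2 * p) (by omega)
      (by omega) hC z' hz'

end Summit.HodgeConjecture.HodgeConjecture.Theorems

end
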